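import Summits.KontsevichZagierPeriods.KontsevichZagierPeriods.Theorems.SymplecticScissorsRealOnePeriodRelationsStubCellsAux
import Summits.KontsevichZagierPeriods.KontsevichZagierPeriods.Theorems.GammaHodgeSector.Negative.Algebraicity
import Literature.NumberTheory.Transcendental.SemialgebraicMapsSmoothProofs
import Literature.NumberTheory.Transcendental.EllIterRep

/-!
# `RealOnePeriodRelations`, line `nash-retraction-thin-strip`, stub `stub_cells`

Stub `stub_cells` of the crux `RealOnePeriodRelations` (stmt-KontsevichZagierPeriods-10042, route
`SymplecticScissors`): every `c ∈ H₁` (the subgroup of `KZ.FormalRep` generated by the one-dimensional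
representations) is, modulo `M₁ = closure (1a ∪ 1b ∪ 2 ∪ Green)`, a `ℤ`-combination
`Σ N(ρ) • [ρ]` of representations `ρ` on the unit interval `{z | z 0 ∈ (0,1)}` whose integrand is `C^∞`
on `(0,1)`. Proof (`Cells.of_mem_cellSpan`, then `AddSubgroup.closure_le`), for one `r : IntegralRep 1`:

* o-minimality of the line with RATIONAL coefficients
  (`GammaHodgeSectorNegative.exists_clopen_off_zeros`): off the real roots of a non-zero `q₁ ∈ ℚ[X]`
  the domain of `r` is open and closed, so every open interval avoiding these (algebraic!) roots lies
  in the domain or misses it (connectedness); likewise the integrand is `C^∞` off a `ℚ`-semialgebraic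
  set with empty interior (`IsSemialgebraicFunOn.exists_contDiffOn_holds`, Bochnak–Coste–Roy §2.9),
  which lies in the root set of a second non-zero `q₂ ∈ ℚ[X]`;
* the window induction `Cells.of_mem_cellSpan_main` over the sorted list of these break points inside
  an algebraic window `(a, b)`: split the domain at a break point `x` (rule 1a; the slice `{z 0 = x}`
  is null), chart the full cells `(x, x')` affinely onto `(0,1)` (rule 2, legitimate because the break
  points are algebraic: `Cells.of_mem_cellSpan_Ioo`);
* the two half lines `{0 < z 0}`, `{z 0 < 0}` are first pushed into the window `(0,1)` by the Möbius
  charts `t ↦ 1 − (1 + t)⁻¹`, `t ↦ (1 − t)⁻¹` (rule 2).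

References: M. Kontsevich, D. Zagier, *Periods* (2001), §1.2; J. Bochnak, M. Coste, M.-F. Roy, *Real
Algebraic Geometry* (1998), §2.3, §2.9.
-/

noncomputable section

open Set MeasureTheory Filter Topology
open scoped ContDiff
open Literature.NumberTheory.Transcendental Literature.ModelTheory.ExponentialFields
open Summit.KontsevichZagierPeriods.SymplecticScissors.RealOnePeriodRelationsNegative (M₁ H₁)

namespace Summit.KontsevichZagierPeriods.SymplecticScissors.RealOnePeriodRelations.Cells

/-! ## The window induction -/

/-- A representation inside a slice `{z 0 = x}` has null domain, hence lies in `cellSpan`.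
[cite: KontsevichZagier2001, §1.2 rule (1)] -/
theorem of_mem_cellSpan_of_subset_slice (r : KZ.IntegralRep 1) (x : ℝ)
    (h : r.domain ⊆ {z | z 0 = x}) : KZ.of r ∈ cellSpan := by
  refine of_mem_cellSpan_of_null r (measure_mono_null h ?_)
  rw [show {z : Fin 1 → ℝ | z 0 = x} = Set.pi univ (fun _ => {x}) by ext z; simp [Fin.forall_fin_one],
    volume_pi_pi]
  simp

/-- **The window induction.** Let `L` be a strictly increasing list of algebraic numbers in the
algebraic window `(a, b)` and `r` a representation inside the window such that every open subinterval
of `[a, b]` avoiding `L` lies in the domain of `r` or misses it, and the integrand is `C^∞` on it in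
the first case. Then `[r] ∈ cellSpan`: split at the first break point (rule 1a), chart the left cell
(rule 2), recurse on the right. [cite: KontsevichZagier2001, §1.2] -/
theorem of_mem_cellSpan_main {b : ℝ} (hb : IsAlgebraic ℚ b) (L : List ℝ) :
    ∀ (a : ℝ) (r : KZ.IntegralRep 1), IsAlgebraic ℚ a → (∀ x ∈ L, IsAlgebraic ℚ x) →
    L.Pairwise (· < ·) → (∀ x ∈ L, a < x ∧ x < b) → r.domain ⊆ {z | z 0 ∈ Ioo a b} →
    (∀ p q : ℝ, a ≤ p → q ≤ b → (∀ x ∈ L, x ∉ Ioo p q) →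
      ({z : Fin 1 → ℝ | z 0 ∈ Ioo p q} ⊆ r.domain ∨ Disjoint {z : Fin 1 → ℝ | z 0 ∈ Ioo p q} r.domain)) →
    (∀ p q : ℝ, a ≤ p → q ≤ b → (∀ x ∈ L, x ∉ Ioo p q) → {z : Fin 1 → ℝ | z 0 ∈ Ioo p q} ⊆ r.domain →
      ContDiffOn ℝ ∞ (fun t => r.integrand (fun _ => t)) (Ioo p q)) →
    KZ.of r ∈ cellSpan := by
  induction L with
  | nil =>
    intro a r ha _ _ _ hdom H1 H2
    exact of_mem_cellSpan_window r ha hb hdom (H1 a b le_rfl le_rfl (by simp))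
      (H2 a b le_rfl le_rfl (by simp))
  | cons x L ih =>
    intro a r ha hLalg hsort hLab hdom H1 H2
    have hx : a < x ∧ x < b := hLab x (by simp)
    have hxalg : IsAlgebraic ℚ x := hLalg x (by simp)
    have hxL : ∀ y ∈ L, x < y := (List.pairwise_cons.mp hsort).1
    have havoid₁ : ∀ y ∈ x :: L, y ∉ Ioo a x := by
      intro y hy hy'
      rcases List.mem_cons.mp hy with rfl | hyL
      · exact lt_irrefl _ hy'.2
      · exact lt_asymm (hxL y hyL) hy'.2
    refine of_mem_cellSpan_of_split_compl r {z | z 0 < x} (KZ.isSemialgebraic_setOf_apply_lt_const hxalg 0)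
      ?_ ?_
    · -- left of `x`: a full or empty window `(a, x)`
      refine of_mem_cellSpan_window _ ha hxalg ?_ ?_ ?_
      · rintro z ⟨hz, hzx⟩
        exact ⟨(hdom hz).1, hzx⟩
      · rcases H1 a x le_rfl hx.2.le havoid₁ with h | h
        · exact Or.inl fun z hz => ⟨h hz, hz.2⟩
        · exact Or.inr (h.mono_right inter_subset_left)
      · intro hsub
        exact H2 a x le_rfl hx.2.le havoid₁ fun z hz => (hsub hz).1
    · -- right of `x`, after removing the null slice `{z 0 = x}`
      set r' := r.restrict (r.domain ∩ {z | z 0 < x}ᶜ)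
        (r.isSemialgebraic_domain.inter (KZ.isSemialgebraic_setOf_apply_lt_const hxalg 0).compl)
        inter_subset_left with hr'
      refine of_mem_cellSpan_of_split_compl r' {z | z 0 = x}
        (isSemialgebraic_setOf_apply_eq_of_isAlgebraic hxalg 0) ?_ ?_
      · exact of_mem_cellSpan_of_subset_slice _ x inter_subset_right
      · have hdom' : r'.domain ∩ {z : Fin 1 → ℝ | z 0 = x}ᶜ ⊆ {z | z 0 ∈ Ioo x b} := by
          intro z hz
          simp only [hr', KZ.IntegralRep.domain_restrict, mem_inter_iff, mem_compl_iff, mem_setOf_eq,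
            not_lt] at hz
          exact ⟨lt_of_le_of_ne hz.1.2 (Ne.symm hz.2), (hdom hz.1.1).2⟩
        have hsub' : ∀ p q : ℝ, x ≤ p → {z : Fin 1 → ℝ | z 0 ∈ Ioo p q} ⊆ r.domain →
            {z : Fin 1 → ℝ | z 0 ∈ Ioo p q} ⊆ r'.domain ∩ {z : Fin 1 → ℝ | z 0 = x}ᶜ := by
          intro p q hp h z hz
          have hxz : x < z 0 := lt_of_le_of_lt hp hz.1
          exact ⟨⟨h hz, not_lt.mpr hxz.le⟩, ne_of_gt hxz⟩
        have havoid : ∀ p q : ℝ, x ≤ p → (∀ y ∈ L, y ∉ Ioo p q) → ∀ y ∈ x :: L, y ∉ Ioo p q := by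
          intro p q hp hL y hy hy'
          rcases List.mem_cons.mp hy with rfl | hyL
          · exact not_le.mpr hy'.1 hp
          · exact hL y hyL hy'
        refine ih x _ hxalg (fun y hy => hLalg y (List.mem_cons_of_mem x hy))
          (List.pairwise_cons.mp hsort).2
          (fun y hy => ⟨hxL y hy, (hLab y (List.mem_cons_of_mem x hy)).2⟩) hdom' ?_ ?_
        · intro p q hp hq hL
          rcases H1 p q (hx.1.le.trans hp) hq (havoid p q hp hL) with h | h
          · exact Or.inl (hsub' p q hp h)
          · exact Or.inr (h.mono_right (inter_subset_left.trans inter_subset_left))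
        · intro p q hp hq hL hsub
          exact H2 p q (hx.1.le.trans hp) hq (havoid p q hp hL)
            (hsub.trans (inter_subset_left.trans inter_subset_left))

/-- **Every representation inside an algebraic window is cellular.** The break points: the real roots
of the non-zero rational polynomials `q₁` (off which the domain is open and closed) and `q₂` (off which
the nowhere dense bad set `Z` of the integrand is open, hence empty); they are algebraic, and between
two consecutive ones the domain is full or empty (connectedness) with smooth integrand.
[cite: BochnakCosteRoy1998, §2.3 and §2.9] -/
theorem of_mem_cellSpan_of_subset_window (r : KZ.IntegralRep 1) {a b : ℝ} (ha : IsAlgebraic ℚ a)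
    (hb : IsAlgebraic ℚ b) (hdom : r.domain ⊆ {z | z 0 ∈ Ioo a b}) : KZ.of r ∈ cellSpan := by
  classical
  -- (i) off the roots of `q₁` the domain is open and closed
  obtain ⟨q₁, hq₁, hopen, hopen'⟩ :=
    GammaHodgeSectorNegative.exists_clopen_off_zeros r.isSemialgebraic_domain
  -- (ii) the integrand is smooth off `Z`, nowhere dense and contained in the roots of `q₂`
  obtain ⟨Z, -, hZsa, hZint, -, hsmooth⟩ := IsSemialgebraicFunOn.exists_contDiffOn_holds
    (s := interior r.domain) isOpen_interior
    (r.isSemialgebraicFunOn_integrand.mono interior_subset (isSemialgebraic_interior r.isSemialgebraic_domain))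
  obtain ⟨q₂, hq₂, hZopen, -⟩ := GammaHodgeSectorNegative.exists_clopen_off_zeros hZsa
  have hZroot : ∀ z ∈ Z, Polynomial.aeval (z 0) q₂ = 0 := by
    intro z hz
    by_contra hne
    have : z ∈ interior Z := interior_maximal inter_subset_left hZopen ⟨hz, hne⟩
    rw [hZint] at this
    exact this
  -- the break points
  have hq : q₁ * q₂ ≠ 0 := mul_ne_zero hq₁ hq₂
  set F : Finset ℝ := ((q₁ * q₂).map (algebraMap ℚ ℝ)).roots.toFinset with hF
  have hmemF : ∀ x : ℝ, x ∈ F ↔ Polynomial.aeval x q₁ = 0 ∨ Polynomial.aeval x q₂ = 0 := by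
    intro x
    rw [hF, Multiset.mem_toFinset, Polynomial.mem_roots
      ((Polynomial.map_ne_zero_iff (algebraMap ℚ ℝ).injective).mpr hq), Polynomial.IsRoot.def,
      Polynomial.eval_map_algebraMap, map_mul, mul_eq_zero]
  have hFalg : ∀ x ∈ F, IsAlgebraic ℚ x := fun x hx =>
    ⟨q₁ * q₂, hq, by rw [map_mul, mul_eq_zero]; exact (hmemF x).mp hx⟩
  set L : List ℝ := (F.filter fun x => a < x ∧ x < b).sort (· ≤ ·) with hL
  have hmemL : ∀ x, x ∈ L ↔ x ∈ F ∧ a < x ∧ x < b := fun x => by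
    simp [hL, Finset.mem_sort, Finset.mem_filter]
  have hsort : L.Pairwise (· < ·) := (Finset.sortedLT_sort _).pairwise
  have havoid : ∀ p q : ℝ, a ≤ p → q ≤ b → (∀ x ∈ L, x ∉ Ioo p q) → ∀ x ∈ F, x ∉ Ioo p q := by
    intro p q hp hq hLpq x hx hxpq
    exact hLpq x ((hmemL x).mpr ⟨hx, lt_of_le_of_lt hp hxpq.1, lt_of_lt_of_le hxpq.2 hq⟩) hxpq
  refine of_mem_cellSpan_main hb L a r ha (fun x hx => hFalg x ((hmemL x).mp hx).1) hsort
    (fun x hx => ((hmemL x).mp hx).2) hdom ?_ ?_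
  · -- an interval avoiding the break points lies in the domain or misses it
    intro p q hp hq' hLpq
    set C : Set (Fin 1 → ℝ) := {z | z 0 ∈ Ioo p q} with hC
    have hCU : C ⊆ {w : Fin 1 → ℝ | Polynomial.aeval (w 0) q₁ ≠ 0} := fun z hz h0 =>
      havoid p q hp hq' hLpq (z 0) ((hmemF _).mpr (Or.inl h0)) hz
    have hCpre : IsPreconnected C := by
      have : C = (fun t : ℝ => (fun _ : Fin 1 => t)) '' Ioo p q := by
        ext z
        exact ⟨fun hz => ⟨z 0, hz, (KZ.eq_const_apply_zero z).symm⟩, fun ⟨t, ht, h⟩ => h ▸ ht⟩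
      rw [this]
      exact isPreconnected_Ioo.image _ (continuous_pi fun _ => continuous_id).continuousOn
    have hdisj : Disjoint (r.domain ∩ {w : Fin 1 → ℝ | Polynomial.aeval (w 0) q₁ ≠ 0})
        (r.domainᶜ ∩ {w : Fin 1 → ℝ | Polynomial.aeval (w 0) q₁ ≠ 0}) :=
      Set.disjoint_left.mpr fun z h₁ h₂ => h₂.1 h₁.1
    have hcover : C ⊆ (r.domain ∩ {w : Fin 1 → ℝ | Polynomial.aeval (w 0) q₁ ≠ 0}) ∪
        (r.domainᶜ ∩ {w : Fin 1 → ℝ | Polynomial.aeval (w 0) q₁ ≠ 0}) := by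
      intro z hz
      by_cases hzS : z ∈ r.domain
      · exact Or.inl ⟨hzS, hCU hz⟩
      · exact Or.inr ⟨hzS, hCU hz⟩
    rcases hCpre.subset_or_subset hopen hopen' hdisj hcover with h | h
    · exact Or.inl (h.trans inter_subset_left)
    · exact Or.inr (Set.disjoint_left.mpr fun z hz hzS => (h hz).1 hzS)
  · -- on such an interval inside the domain the integrand is smooth
    intro p q hp hq' hLpq hsub
    have h1 : {z : Fin 1 → ℝ | z 0 ∈ Ioo p q} ⊆ interior r.domain \ Z := by
      intro z hz
      refine ⟨interior_maximal hsub (isOpen_Ioo.preimage (continuous_apply 0)) hz, fun hzZ => ?_⟩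
      exact havoid p q hp hq' hLpq (z 0) ((hmemF _).mpr (Or.inr (hZroot z hzZ))) hz
    have h3 : ContDiff ℝ ∞ (fun t : ℝ => (fun _ : Fin 1 => t)) := contDiff_pi.mpr fun _ => contDiff_id
    exact (hsmooth.mono h1).comp h3.contDiffOn fun t ht => ht

/-! ## From the line to a bounded window -/

/-- The right half line `{0 < z 0}` is pushed into the window `(0, 1)` by the chart `t ↦ 1 − (1 + t)⁻¹`
(rule 2). [cite: KontsevichZagier2001, §1.2 rule (2)] -/
theorem of_mem_cellSpan_of_pos (r : KZ.IntegralRep 1) (hdom : r.domain ⊆ {z | 0 < z 0}) :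
    KZ.of r ∈ cellSpan := by
  have hσ := r.isSemialgebraic_domain
  have hpos : ∀ p ∈ r.domain, 0 < 1 + p 0 := fun p hp => by linarith [show 0 < p 0 from hdom hp]
  have h1 : IsSemialgebraicFunOn ℚ r.domain (fun p => (1 + p 0)⁻¹) :=
    ((isSemialgebraicFunOn_const_ratCast hσ 1).fun_add (isSemialgebraicFunOn_apply hσ 0)).fun_inv.congr
      fun p _ => by simp
  have hder : ∀ p ∈ r.domain, HasDerivAt (fun t : ℝ => 1 - (1 + t)⁻¹) (((1 + p 0)⁻¹) ^ 2) (p 0) := by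
    intro p hp
    refine ((((hasDerivAt_id' (p 0)).const_add 1).fun_inv (hpos p hp).ne').const_sub 1).congr_deriv ?_
    rw [neg_div, neg_neg, one_div, inv_pow]
  have hne : ∀ p ∈ r.domain, ((1 + p 0)⁻¹) ^ 2 ≠ 0 := fun p hp =>
    pow_ne_zero 2 (inv_ne_zero (hpos p hp).ne')
  have hinj : InjOn (fun p : Fin 1 → ℝ => fun _ : Fin 1 => 1 - (1 + p 0)⁻¹) r.domain := by
    intro p hp p' hp' h
    have h0 : 1 - (1 + p 0)⁻¹ = 1 - (1 + p' 0)⁻¹ := congrFun h 0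
    have : p 0 = p' 0 := by
      have := inv_injective (sub_right_injective h0)
      linarith
    rw [KZ.eq_const_apply_zero p, KZ.eq_const_apply_zero p', this]
  obtain ⟨s, hs, -, hrel⟩ := helper_cells_1 r (fun t => 1 - (1 + t)⁻¹) (fun t => ((1 + t)⁻¹) ^ 2)
    (((isSemialgebraicFunOn_const_ratCast hσ 1).fun_sub h1).congr fun p _ => by simp) (h1.fun_pow 2)
    hder hne hinj
  refine mem_cellSpan_of_sub_mem (of_mem_cellSpan_of_subset_window s isAlgebraic_zero isAlgebraic_one ?_)
    hrel
  rw [hs]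
  rintro _ ⟨p, hp, rfl⟩
  have h := hpos p hp
  have h0 : 0 < p 0 := hdom hp
  exact ⟨by simpa using inv_lt_one_of_one_lt₀ (by linarith), by simpa using h⟩

/-- The left half line `{z 0 < 0}` is pushed into the window `(0, 1)` by the chart `t ↦ (1 − t)⁻¹`
(rule 2). [cite: KontsevichZagier2001, §1.2 rule (2)] -/
theorem of_mem_cellSpan_of_neg (r : KZ.IntegralRep 1) (hdom : r.domain ⊆ {z | z 0 < 0}) :
    KZ.of r ∈ cellSpan := by
  have hσ := r.isSemialgebraic_domain
  have hpos : ∀ p ∈ r.domain, 0 < 1 - p 0 := fun p hp => by linarith [show p 0 < 0 from hdom hp]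
  have h1 : IsSemialgebraicFunOn ℚ r.domain (fun p => (1 - p 0)⁻¹) :=
    ((isSemialgebraicFunOn_const_ratCast hσ 1).fun_sub (isSemialgebraicFunOn_apply hσ 0)).fun_inv.congr
      fun p _ => by simp
  have hder : ∀ p ∈ r.domain, HasDerivAt (fun t : ℝ => (1 - t)⁻¹) (((1 - p 0)⁻¹) ^ 2) (p 0) := by
    intro p hp
    refine (((hasDerivAt_id' (p 0)).const_sub 1).fun_inv (hpos p hp).ne').congr_deriv ?_
    rw [neg_neg, one_div, inv_pow]
  have hne : ∀ p ∈ r.domain, ((1 - p 0)⁻¹) ^ 2 ≠ 0 := fun p hp =>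
    pow_ne_zero 2 (inv_ne_zero (hpos p hp).ne')
  have hinj : InjOn (fun p : Fin 1 → ℝ => fun _ : Fin 1 => (1 - p 0)⁻¹) r.domain := by
    intro p hp p' hp' h
    have h0 : (1 - p 0)⁻¹ = (1 - p' 0)⁻¹ := congrFun h 0
    have : p 0 = p' 0 := by
      have := inv_injective h0
      linarith
    rw [KZ.eq_const_apply_zero p, KZ.eq_const_apply_zero p', this]
  obtain ⟨s, hs, -, hrel⟩ := helper_cells_1 r (fun t => (1 - t)⁻¹) (fun t => ((1 - t)⁻¹) ^ 2)
    h1 (h1.fun_pow 2) hder hne hinj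
  refine mem_cellSpan_of_sub_mem (of_mem_cellSpan_of_subset_window s isAlgebraic_zero isAlgebraic_one ?_)
    hrel
  rw [hs]
  rintro _ ⟨p, hp, rfl⟩
  have h := hpos p hp
  have h0 : p 0 < 0 := hdom hp
  exact ⟨by simpa using h, by simpa using inv_lt_one_of_one_lt₀ (by linarith)⟩

/-- **Every one-dimensional representation is cellular**: split at `0` (rule 1a; the slice `{z 0 = 0}`
is null) and push the two half lines into the unit window. [cite: KontsevichZagier2001, §1.2] -/
theorem of_mem_cellSpan (r : KZ.IntegralRep 1) : KZ.of r ∈ cellSpan := by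
  refine of_mem_cellSpan_of_split_compl r {z | z 0 < 0} ?_ (of_mem_cellSpan_of_neg _ inter_subset_right) ?_
  · simpa using KZ.isSemialgebraic_setOf_apply_lt_const isAlgebraic_zero (0 : Fin 1)
  · set r' := r.restrict (r.domain ∩ {z : Fin 1 → ℝ | z 0 < 0}ᶜ) _ inter_subset_left with hr'
    refine of_mem_cellSpan_of_split_compl r' {z | z 0 = 0} ?_
      (of_mem_cellSpan_of_subset_slice _ 0 inter_subset_right) (of_mem_cellSpan_of_pos _ ?_)
    · simpa using isSemialgebraic_setOf_apply_eq_of_isAlgebraic isAlgebraic_zero (0 : Fin 1)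
    · intro z hz
      simp only [hr', KZ.IntegralRep.domain_restrict, mem_inter_iff, mem_compl_iff, mem_setOf_eq,
        not_lt] at hz
      exact lt_of_le_of_ne hz.1.2 (Ne.symm hz.2)

end Summit.KontsevichZagierPeriods.SymplecticScissors.RealOnePeriodRelations.Cells

namespace Summit.KontsevichZagierPeriods.SymplecticScissors.RealOnePeriodRelations

/-- **Stub `stub_cells`** (line `nash-retraction-thin-strip`). Every `c ∈ H₁` is, modulo `M₁`, a
`ℤ`-combination of representations on the unit interval `{z | z 0 ∈ (0,1)}` whose integrand is `C^∞`
on `(0,1)` (`Cells.of_mem_cellSpan` for the generators, `AddSubgroup.closure_le` for `H₁`).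
[cite: KontsevichZagier2001, §1.2] -/
theorem stub_cells : ∀ c : KZ.FormalRep, c ∈ H₁ →
    ∃ N : KZ.IntegralRep 1 →₀ ℤ,
      (∀ ρ ∈ N.support, ρ.domain = {z | z 0 ∈ Set.Ioo (0 : ℝ) 1} ∧
        ContDiffOn ℝ ((⊤ : ℕ∞) : WithTop ℕ∞) (fun t : ℝ => ρ.integrand (fun _ : Fin 1 => t)) (Set.Ioo (0 : ℝ) 1)) ∧
      c - N.sum (fun ρ m => m • KZ.of ρ) ∈ M₁ := by
  intro c hc
  have h : H₁ ≤ Cells.cellSpan :=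
    (AddSubgroup.closure_le _).mpr (by rintro _ ⟨r, rfl⟩; exact Cells.of_mem_cellSpan r)
  obtain ⟨N, hN, hcN⟩ := h hc
  exact ⟨N, hN, hcN⟩

end Summit.KontsevichZagierPeriods.SymplecticScissors.RealOnePeriodRelations

end
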